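import Literature.Computability.AlgebraicComplexity.LMR13PLambdaStabilizerSplit
import Literature.Computability.AlgebraicComplexity.SkewPairingMatrices
import HarnessLib

/-!
# LMR13 §3.5, stabiliser of `P_Λ`: block (I), first test family (T1) — diagonal vanishing

[topic Computability/AlgebraicComplexity]

Landsberg–Manivel–Ressayre 2013, §3.5 (journal p. 481; arXiv:1004.4802 `p0008.txt:L82–88`): the
`Hom(Λ²,S²) = 𝔰𝔩_n ⊕ EAS`-component of the stabiliser of `P_Λ` is `𝔰𝔩_n`. In the elementary route of the
cell memo `HOME/lmr/X3b-ELEMENTARY-ROUTE-t10g4.md` §4 this block is the identity (I)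
`tr(adj(A)·(L_X A)_sym) = 0` (`pLambda_glAnn_blocks`), exploited at the sparse corank-one points; this file
proves its FIRST consequence (test family T1, kernel vector `e_r`): for `X ∈ glAnn (pLambda n)`, `n = h+h+1`,
and distinct indices `p, q ≠ r`,  **`(L_X(E_pq − E_qp))_{rr} = 0`** (`linAct_wedge_apply_self_eq_zero`) — the
diagonal entries `ψ(e_p∧e_q)_{rr}`, `r ∉ {p,q}`, of the `Hom(Λ²,S²)`-block vanish. Ingredients:
`adj(R_rΩ) = detΩ·E_rr` (`adjugate_padAt`), the signed matching matrices `J(π,s)` and their pair-differences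
(`SkewPairingMatrices.lean`), and `padAt_single` (the padding of an elementary matrix is elementary). The
remaining test families T2–T4 and the `n² − 1` functionals of the memo are the successor's items.

Everything is PROVED; theorems only; no named fact. Honest framing: a step of one block of (X3b);
`LMR2013_prop_3_5_1` remains OPEN in the tree; VP ≠ VNP is NOT proved and nothing here is progress on it.

## References

* [LandsbergManivelRessayre2013] J. M. Landsberg, L. Manivel, N. Ressayre, *Hypersurfaces with degenerate duals and
  the geometric complexity theory program*, Comment. Math. Helv. 88 (2013) 469–484, §3.5 (p. 481).
-/

noncomputable section

open Matrix

namespace Literature.Computability.AlgebraicComplexity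

namespace SkewAdj

variable {m : ℕ}

/-- Padding is compatible with subtraction. [cite: LandsbergManivelRessayre2013, §3.5 (p. 481)] -/
theorem padAt_sub (r : Fin (m + 1)) (Ω Ω' : Matrix (Fin m) (Fin m) ℂ) :
    padAt r (Ω - Ω') = padAt r Ω - padAt r Ω' := by
  ext a b
  rcases Fin.eq_self_or_eq_succAbove r a with rfl | ⟨a', rfl⟩
  · simp
  · rcases Fin.eq_self_or_eq_succAbove r b with rfl | ⟨b', rfl⟩
    · simp
    · simp

/-- Padding is compatible with scalars. [cite: LandsbergManivelRessayre2013, §3.5 (p. 481)] -/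
theorem padAt_smul (r : Fin (m + 1)) (c : ℂ) (Ω : Matrix (Fin m) (Fin m) ℂ) :
    padAt r (c • Ω) = c • padAt r Ω := by
  ext a b
  rcases Fin.eq_self_or_eq_succAbove r a with rfl | ⟨a', rfl⟩
  · simp
  · rcases Fin.eq_self_or_eq_succAbove r b with rfl | ⟨b', rfl⟩
    · simp
    · simp

/-- The padding of an elementary matrix is elementary. [cite: LandsbergManivelRessayre2013, §3.5 (p. 481)] -/
theorem padAt_single (r : Fin (m + 1)) (a b : Fin m) (c : ℂ) :
    padAt r (Matrix.single a b c) = Matrix.single (r.succAbove a) (r.succAbove b) c := by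
  ext i j
  rcases Fin.eq_self_or_eq_succAbove r i with rfl | ⟨i', rfl⟩
  · rw [padAt_apply_left, Matrix.single_apply_of_row_ne (Fin.succAbove_ne _ a)]
  · rcases Fin.eq_self_or_eq_succAbove r j with rfl | ⟨j', rfl⟩
    · rw [padAt_apply_right, Matrix.single_apply_of_col_ne _ _ (Fin.succAbove_ne _ b)]
    · rw [padAt_apply_succAbove]
      by_cases h : a = i' ∧ b = j'
      · obtain ⟨rfl, rfl⟩ := h
        rw [Matrix.single_apply_same, Matrix.single_apply_same]
      · have h' : ¬(r.succAbove a = r.succAbove i' ∧ r.succAbove b = r.succAbove j') := by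
          rintro ⟨h1, h2⟩
          exact h ⟨Fin.succAbove_right_injective h1, Fin.succAbove_right_injective h2⟩
        rw [Matrix.single_apply_of_ne (h := h), Matrix.single_apply_of_ne (h := h')]

/-- `L_X` is compatible with subtraction. [cite: LandsbergManivelRessayre2013, §3.5 (p. 481)] -/
theorem linAct_sub (X : Matrix (Fin m × Fin m) (Fin m × Fin m) ℂ) (S T : Matrix (Fin m) (Fin m) ℂ) :
    (Matrix.of fun k l => ∑ p : Fin m × Fin m, X p (k, l) * (S - T) p.1 p.2) =
      (Matrix.of fun k l => ∑ p : Fin m × Fin m, X p (k, l) * S p.1 p.2) -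
        (Matrix.of fun k l => ∑ p : Fin m × Fin m, X p (k, l) * T p.1 p.2) := by
  have h := linAct_add_smul X S T (-1)
  rw [neg_one_smul, neg_one_smul, ← sub_eq_add_neg, ← sub_eq_add_neg] at h
  exact h

/-- `L_X` is compatible with scalars. [cite: LandsbergManivelRessayre2013, §3.5 (p. 481)] -/
theorem linAct_smul (X : Matrix (Fin m × Fin m) (Fin m × Fin m) ℂ) (c : ℂ) (S : Matrix (Fin m) (Fin m) ℂ) :
    (Matrix.of fun k l => ∑ p : Fin m × Fin m, X p (k, l) * (c • S) p.1 p.2) =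
      c • (Matrix.of fun k l => ∑ p : Fin m × Fin m, X p (k, l) * S p.1 p.2) := by
  have h := linAct_add_smul X 0 S c
  simp only [zero_add, Matrix.zero_apply, mul_zero, Finset.sum_const_zero] at h
  rw [h]
  ext k l
  simp

/-- **Block (I) at the sparse point `R_r(Ω)`**: for `X ∈ 𝔤𝔩(W)_{P_Λ}` (`n = m+1` odd) and `Ω` invertible skew,
`(L_X (R_rΩ))_{rr} = 0` (from `tr(adj(R_rΩ)·(L_X R_rΩ)_sym) = 0` and `adj(R_rΩ) = detΩ·E_rr`).
[cite: LandsbergManivelRessayre2013, §3.5 (p. 481)] -/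
theorem linAct_padAt_apply_self_eq_zero (_hm : Odd (m + 1))
    {X : Matrix (Fin (m + 1) × Fin (m + 1)) (Fin (m + 1) × Fin (m + 1)) ℂ} (hX : X ∈ glAnn (pLambda (m + 1)))
    (r : Fin (m + 1)) {Ω : Matrix (Fin m) (Fin m) ℂ} (hΩ : Ωᵀ = -Ω) (hΩu : IsUnit Ω.det) :
    (Matrix.of fun k l => ∑ p : Fin (m + 1) × Fin (m + 1), X p (k, l) * padAt r Ω p.1 p.2) r r = 0 := by
  have hR₀skew : (padAt r Ω)ᵀ = -padAt r Ω := by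
    rw [padAt_transpose, hΩ]
    ext a b
    rcases Fin.eq_self_or_eq_succAbove r a with rfl | ⟨a', rfl⟩
    · simp
    · rcases Fin.eq_self_or_eq_succAbove r b with rfl | ⟨b', rfl⟩
      · simp
      · simp
  -- any symmetric `S` will do for block (I); take `S = 0`
  have h := (pLambda_glAnn_blocks (Nat.succ_ne_zero m) hX hR₀skew
    (show (0 : Matrix (Fin (m + 1)) (Fin (m + 1)) ℂ)ᵀ = 0 from Matrix.transpose_zero)).1
  set N := (Matrix.of fun k l => ∑ p : Fin (m + 1) × Fin (m + 1), X p (k, l) * padAt r Ω p.1 p.2) with hN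
  rw [adjugate_padAt, Matrix.smul_mul, Matrix.trace_smul, smul_eq_mul, mul_eq_zero] at h
  rcases h with h | h
  · exact absurd h hΩu.ne_zero
  · have htr : Matrix.trace (Matrix.single r r (1 : ℂ) * ((1 / 2 : ℂ) • (N + Nᵀ))) =
        ((1 / 2 : ℂ) • (N + Nᵀ)) r r := by
      simp only [Matrix.trace, Matrix.diag]
      rw [Fintype.sum_eq_single r (fun a ha => Matrix.single_mul_apply_of_ne (c := (1 : ℂ)) r r a a ha _),
        Matrix.single_mul_apply_same, one_mul]
    rw [htr, Matrix.smul_apply, Matrix.add_apply, Matrix.transpose_apply, smul_eq_mul, mul_eq_zero] at h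
    rcases h with h | h
    · norm_num at h
    · linear_combination h / 2

/-- **Test family T1 of block (I)** (memo §4): for `X ∈ 𝔤𝔩(W)_{P_Λ}`, `n = h+h+1`, `r` and `a ≠ b` in the
indices `≠ r`: `(L_X(E_{pq} − E_{qp}))_{rr} = 0` with `p = r.succAbove a`, `q = r.succAbove b` — obtained from
`linAct_padAt_apply_self_eq_zero` at the two signed matching matrices `J(π,s)`, `J(π,s')` (`π a = b`, `s'` the
weight bumped on the pair `{a,b}`), whose difference is `s_a·(E_ab − E_ba)`.
[cite: LandsbergManivelRessayre2013, §3.5 (p. 481)] -/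
theorem linAct_wedge_apply_self_eq_zero {h : ℕ}
    {X : Matrix (Fin (h + h + 1) × Fin (h + h + 1)) (Fin (h + h + 1) × Fin (h + h + 1)) ℂ}
    (hX : X ∈ glAnn (pLambda (h + h + 1))) (r : Fin (h + h + 1)) {a b : Fin (h + h)} (hab : a ≠ b) :
    (Matrix.of fun k l => ∑ p : Fin (h + h + 1) × Fin (h + h + 1), X p (k, l) *
      (Matrix.single (r.succAbove a) (r.succAbove b) (1 : ℂ) -
        Matrix.single (r.succAbove b) (r.succAbove a) (1 : ℂ)) p.1 p.2) r r = 0 := by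
  have hm : Odd (h + h + 1) := ⟨h, by ring⟩
  obtain ⟨π, hπ, hfix, hπa⟩ := exists_involution_apply_eq hab
  set s : Fin (h + h) → ℂ := fun x => if x < π x then (1 : ℂ) else -1 with hs_def
  have hs : ∀ x, s (π x) = -s x := fun x => by
    simp only [hs_def]
    rw [hπ]
    rcases lt_or_gt_of_ne (hfix x) with hlt | hgt
    · rw [if_pos hlt, if_neg (not_lt.2 hlt.le), neg_neg]
    · rw [if_neg (not_lt.2 hgt.le), if_pos hgt]
  have hs0 : ∀ x, s x ≠ 0 := fun x => by
    simp only [hs_def]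
    split_ifs
    · exact one_ne_zero
    · exact neg_ne_zero.2 one_ne_zero
  have e1 := linAct_padAt_apply_self_eq_zero hm hX r (pairMat_transpose hπ hs) (isUnit_det_pairMat hπ hs hs0)
  have e2 := linAct_padAt_apply_self_eq_zero hm hX r (pairMat_transpose hπ (bumpWeight_antisymm hπ hs a))
    (isUnit_det_pairMat hπ (bumpWeight_antisymm hπ hs a) (bumpWeight_ne_zero π hs0 a))
  have hdiff := congrFun (congrFun (linAct_sub X (padAt r (pairMat π (bumpWeight π s a))) (padAt r (pairMat π s)))
    r) r
  rw [Matrix.sub_apply, e1, e2, sub_zero, ← padAt_sub, pairMat_bumpWeight_sub hπ hfix hs, padAt_smul, linAct_smul,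
    Matrix.smul_apply, smul_eq_mul, padAt_sub, padAt_single, padAt_single, hπa, mul_eq_zero] at hdiff
  rcases hdiff with hdiff | hdiff
  · exact absurd hdiff (hs0 a)
  · exact hdiff

end SkewAdj

end Literature.Computability.AlgebraicComplexity

end
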